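import Summits.AtomisticToContinuum.Crystallization.Theorems.FrustratedLawDichotomyLocalPricing
import Summits.AtomisticToContinuum.Crystallization.Theorems.FrustratedLawDichotomyTailFloorAnnulus

/-!
# FrustratedLawDichotomy · «LocalDischargingRule»: the RESTRICTED transfer class beneath T′_R / FRG_R / E′_R (critic row 487 (2a))

`…LocalPricing` (p827285) proved that lens-5's finite-range residuals are EXACTLY «sitewise after ARBITRARY pair transfers» (bookkeeping /
sanity: net flow `Σ_i (Σ_j τ j i − Σ_j τ i j) = 0` one way, the equalising transfer the other).  Critic row 487: the CONTENT door is the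
RESTRICTED class — transfers given by a RULE `F` (one transfer matrix `F N y : Fin N → Fin N → ℝ` for every finite cluster `y`, «site `i`
sends `F N y i j` to site `j`») which is

* `HasRange R′ F`   — FINITE RANGE: `F N y i j = 0` whenever `dist (y i) (y j) > R′`;
* `IsLocal ρ F`     — A LOCAL RULE of radius `ρ`: the transfer on a pair is DETERMINED BY THE `ρ`-NEIGHBOURHOOD OF ITS TWO ENDPOINTS — stated as
                      invariance under passing to ANY sub-cluster `z = y ∘ φ` (`φ` injective) that still contains every atom of `y` within `ρ` of
                      either endpoint;
* `IsBounded B F`   — BOUNDED: `|F N y i j| ≤ B`;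

and which CERTIFIES the residual sitewise: at EVERY site of EVERY injective `7/10`-separated cluster,
`level_i ≤ ½·Σ_j truncLJ R (r_ij) − A·m_i + (Σ_j F N y j i − Σ_j F N y i j)` with the level of the residual's class
(`eUp + κ_T·𝟙[loosely bad] − C_T·𝟙[tightly good]` for T′_R; `e₁ − C·𝟙[tightly good]` for FRG_R; the four-term elastic level for E′_R).
These are the definitions `LocalDischargingRuleT` / `LocalDischargingRuleF` / `LocalDischargingRuleE` below (parameters `R′ ρ B` explicit, so a
census engine can search rules motif by motif: by `HasRange`/`IsLocal` the certificate at a site reads only the atoms within `max R 1` of it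
for the site terms and within `R′ + ρ` of it for the transfers — see `netInflow_eq_sum_filter`).

PROVED here: the kernels `finiteRangeTopologicalPricing_of_rule`, `finiteRangeFrustrationGap_of_rule`, `finiteRangeElastic_of_rule` (each
restricted class ⟹ its residual, STRONGER-or-equal by construction; the restrictions are simply not used — that is the point: they constrain
the SEARCH, not the soundness), monotonicity of the class in `R′ ρ B`, the zero rule as the sitewise (transfer-free) special case, and the crux
BY NAME at the residual of record `T′_7` with the PROVED floor `1/324` (`…TailFloorAnnulus.tailFloor_seven_324`, hand-1 g12 p827055):
`aperiodicFrustratedLawGap_of_ruleT_seven`, plus the generic `…_of_ruleT_tf` / `…_of_ruleF_tf` (any `R > 0`, layer-cake floor).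
[folklore] bookkeeping (discharging); 0 sorry.  Prover hand 2, gen 12 (decomp-a2c), `--supports stmt-AtomisticToContinuum-27623`.
-/

noncomputable section

namespace Summit.AtomisticToContinuum.Crystallization.Theorems.FrustratedLawDichotomyLocalDischargingRule

open scoped BigOperators Classical
open Literature.MathematicalPhysics.StatisticalMechanics (interactionEnergy lennardJones)
open Summit.AtomisticToContinuum.Crystallization.Theorems.ChargedEnergyGapNegative (E3 eStar)
open Summit.AtomisticToContinuum.Crystallization.Theorems.FrustratedLawDichotomyRangeCut
open Summit.AtomisticToContinuum.Crystallization.Theorems.FrustratedLawDichotomyTailFloor (tailFloor_holds tailFloor_seven_324)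
open Summit.AtomisticToContinuum.Crystallization.Theorems.FrustratedLawDichotomyLocalPricing

/-! ## §1. Transfer rules and the three restrictions -/

/-- **A PAIR-TRANSFER RULE**: for every finite cluster `y : Fin N → ℝ³` a transfer matrix; `F N y i j` is what site `i` sends to site `j`. -/
abbrev TransferRule : Type := ∀ N : ℕ, (Fin N → E3) → Fin N → Fin N → ℝ

/-- The NET INFLOW at site `i` under the rule `F`: received minus sent. -/
def netInflow (F : TransferRule) (N : ℕ) (y : Fin N → E3) (i : Fin N) : ℝ :=
  ∑ j, F N y j i - ∑ j, F N y i j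

/-- **FINITE RANGE `R′`**: no transfer across a distance `> R′`. -/
def HasRange (R' : ℝ) (F : TransferRule) : Prop :=
  ∀ (N : ℕ) (y : Fin N → E3) (i j : Fin N), R' < dist (y i) (y j) → F N y i j = 0

/-- **LOCALITY of radius `ρ`** (a RULE, not an oracle): the transfer on the pair `(i, j)` is unchanged when the cluster is replaced by ANY
sub-cluster `z = y ∘ φ` (`φ : Fin M → Fin N` injective) which still contains every atom of `y` lying within `ρ` of `y i` or of `y j` —
i.e. `F` reads only the `ρ`-neighbourhood of the two endpoints. -/
def IsLocal (ρ : ℝ) (F : TransferRule) : Prop :=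
  ∀ (N M : ℕ) (y : Fin N → E3) (φ : Fin M → Fin N), Function.Injective φ →
    ∀ a b : Fin M, (∀ k : Fin N, dist (y k) (y (φ a)) ≤ ρ ∨ dist (y k) (y (φ b)) ≤ ρ → k ∈ Set.range φ) →
      F M (y ∘ φ) a b = F N y (φ a) (φ b)

/-- **BOUNDEDNESS by `B`**. -/
def IsBounded (B : ℝ) (F : TransferRule) : Prop :=
  ∀ (N : ℕ) (y : Fin N → E3) (i j : Fin N), |F N y i j| ≤ B

/-- `HasRange` is monotone in the range. [folklore] -/
theorem HasRange.mono {R' R'' : ℝ} {F : TransferRule} (h : HasRange R' F) (hle : R' ≤ R'') : HasRange R'' F :=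
  fun N y i j hd => h N y i j (lt_of_le_of_lt hle hd)

/-- `IsLocal` is monotone in the radius (a larger neighbourhood determines a fortiori). [folklore] -/
theorem IsLocal.mono {ρ ρ' : ℝ} {F : TransferRule} (h : IsLocal ρ F) (hle : ρ ≤ ρ') : IsLocal ρ' F :=
  fun N M y φ hφ a b hsub => h N M y φ hφ a b fun k hk => hsub k (hk.imp (fun h1 => h1.trans hle) fun h2 => h2.trans hle)

/-- `IsBounded` is monotone in the bound. [folklore] -/
theorem IsBounded.mono {B B' : ℝ} {F : TransferRule} (h : IsBounded B F) (hle : B ≤ B') : IsBounded B' F :=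
  fun N y i j => (h N y i j).trans hle

/-- The zero rule (no transfers: plain sitewise pricing) has every range, every locality radius and every nonnegative bound. [folklore] -/
theorem zero_rule_restricted {R' ρ B : ℝ} (hB : 0 ≤ B) :
    HasRange R' (fun _ _ _ _ => 0) ∧ IsLocal ρ (fun _ _ _ _ => 0) ∧ IsBounded B (fun _ _ _ _ => 0) :=
  ⟨fun _ _ _ _ _ => rfl, fun _ _ _ _ _ _ _ _ => rfl, fun _ _ _ _ => by simpa using hB⟩

/-- Under a rule of range `R′` the net inflow at `i` only involves the sites within `R′` of `y i`. [folklore] -/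
theorem netInflow_eq_sum_filter {R' : ℝ} {F : TransferRule} (hF : HasRange R' F) (N : ℕ) (y : Fin N → E3) (i : Fin N) :
    netInflow F N y i =
      ∑ j ∈ Finset.univ.filter (fun j => dist (y j) (y i) ≤ R'), F N y j i
        - ∑ j ∈ Finset.univ.filter (fun j => dist (y j) (y i) ≤ R'), F N y i j := by
  unfold netInflow
  rw [Finset.sum_filter, Finset.sum_filter]
  congr 1
  · refine Finset.sum_congr rfl fun j _ => ?_
    split_ifs with h
    · rfl
    · exact hF N y j i (lt_of_not_ge h)
  · refine Finset.sum_congr rfl fun j _ => ?_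
    split_ifs with h
    · rfl
    · rw [dist_comm] at h
      exact hF N y i j (lt_of_not_ge h)

/-! ## §2. The restricted classes beneath the three finite-range residuals -/

/-- **`LocalDischargingRuleT η₀ η₁ R A eUp κT CT R′ ρ B F`** — the restricted class beneath `T′_R = FiniteRangeTopologicalPricing η₀ η₁ R A eUp κT CT`:
`F` has range `R′`, locality radius `ρ`, bound `B`, and at EVERY site of EVERY injective `7/10`-separated cluster
`eUp + κ_T·𝟙[¬ η₁-good] − C_T·𝟙[η₀-good] ≤ ½·Σ_j truncLJ R (r_ij) − A·m_i + netInflow_i`. -/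
def LocalDischargingRuleT (η₀ η₁ R A eUp κT CT R' ρ B : ℝ) (F : TransferRule) : Prop :=
  HasRange R' F ∧ IsLocal ρ F ∧ IsBounded B F ∧
    ∀ (N : ℕ) (y : Fin N → E3), Function.Injective y → Sep y → ∀ i : Fin N,
      eUp + κT * (1 - (if GoodAt η₁ y i then (1 : ℝ) else 0)) - CT * (if GoodAt η₀ y i then (1 : ℝ) else 0) ≤
        (∑ j, truncLJ R (dist (y i) (y j))) / 2 - A * densityProxy y i + netInflow F N y i

/-- **`LocalDischargingRuleF R A e₁ C R′ ρ B F`** — the restricted class beneath `FRG_R = FiniteRangeFrustrationGap R A e₁ C`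
(level `e₁ − C·𝟙[1/20-good]`). -/
def LocalDischargingRuleF (R A e₁ C R' ρ B : ℝ) (F : TransferRule) : Prop :=
  HasRange R' F ∧ IsLocal ρ F ∧ IsBounded B F ∧
    ∀ (N : ℕ) (y : Fin N → E3), Function.Injective y → Sep y → ∀ i : Fin N,
      e₁ - C * (if GoodAt (1 / 20) y i then (1 : ℝ) else 0) ≤
        (∑ j, truncLJ R (dist (y i) (y j))) / 2 - A * densityProxy y i + netInflow F N y i

/-- **`LocalDischargingRuleE η₀ η₁ R A eUp κE CE DE R′ ρ B F`** — the restricted class beneath the finite-range ELASTIC inequality `E′_R`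
(level `eUp + κ_E·(𝟙[η₁-good] − 𝟙[η₀-good]) − C_E·𝟙[η₀-good] − D_E·𝟙[¬ η₁-good]`). -/
def LocalDischargingRuleE (η₀ η₁ R A eUp κE CE DE R' ρ B : ℝ) (F : TransferRule) : Prop :=
  HasRange R' F ∧ IsLocal ρ F ∧ IsBounded B F ∧
    ∀ (N : ℕ) (y : Fin N → E3), Function.Injective y → Sep y → ∀ i : Fin N,
      eUp + κE * ((if GoodAt η₁ y i then (1 : ℝ) else 0) - (if GoodAt η₀ y i then (1 : ℝ) else 0))
          - CE * (if GoodAt η₀ y i then (1 : ℝ) else 0) - DE * (1 - (if GoodAt η₁ y i then (1 : ℝ) else 0)) ≤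
        (∑ j, truncLJ R (dist (y i) (y j))) / 2 - A * densityProxy y i + netInflow F N y i

/-! ## §3. Kernels: each restricted class implies its residual (the restrictions constrain the search, not the soundness) -/

/-- ★ **`LocalDischargingRuleT … F ⟹ T′_R`**. [folklore] -/
theorem finiteRangeTopologicalPricing_of_rule {η₀ η₁ R A eUp κT CT R' ρ B : ℝ} {F : TransferRule}
    (h : LocalDischargingRuleT η₀ η₁ R A eUp κT CT R' ρ B F) : FiniteRangeTopologicalPricing η₀ η₁ R A eUp κT CT :=
  finiteRangeTopologicalPricing_of_sitewise fun N y hy hsep => ⟨F N y, h.2.2.2 N y hy hsep⟩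

/-- ★ **`LocalDischargingRuleF … F ⟹ FRG_R`**. [folklore] -/
theorem finiteRangeFrustrationGap_of_rule {R A e₁ C R' ρ B : ℝ} {F : TransferRule}
    (h : LocalDischargingRuleF R A e₁ C R' ρ B F) : FiniteRangeFrustrationGap R A e₁ C :=
  finiteRangeFrustrationGap_of_sitewise fun N y hy hsep => ⟨F N y, h.2.2.2 N y hy hsep⟩

/-- ★ **`LocalDischargingRuleE … F ⟹ E′_R`** (the finite-range elastic inequality, inline as in `…LocalPricing`). [folklore] -/
theorem finiteRangeElastic_of_rule {η₀ η₁ R A eUp κE CE DE R' ρ B : ℝ} {F : TransferRule}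
    (h : LocalDischargingRuleE η₀ η₁ R A eUp κE CE DE R' ρ B F)
    (N : ℕ) (y : Fin N → E3) (hy : Function.Injective y) (hsep : Sep y) :
    eUp * N + κE * ((goodCount η₁ y : ℝ) - goodCount η₀ y) - CE * goodCount η₀ y - DE * ((N : ℝ) - goodCount η₁ y) ≤
      interactionEnergy (truncLJ R) y - A * ∑ i, densityProxy y i :=
  finiteRangeElastic_of_sitewise (fun N y hy hsep => ⟨F N y, h.2.2.2 N y hy hsep⟩) N y hy hsep

/-- The classes are monotone in the restrictions `R′ ρ B` (loosening them keeps a certificate). [folklore] -/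
theorem LocalDischargingRuleT.mono {η₀ η₁ R A eUp κT CT R' ρ B R'' ρ' B' : ℝ} {F : TransferRule}
    (h : LocalDischargingRuleT η₀ η₁ R A eUp κT CT R' ρ B F) (hR : R' ≤ R'') (hρ : ρ ≤ ρ') (hB : B ≤ B') :
    LocalDischargingRuleT η₀ η₁ R A eUp κT CT R'' ρ' B' F :=
  ⟨h.1.mono hR, h.2.1.mono hρ, h.2.2.1.mono hB, h.2.2.2⟩

/-- The transfer-free special case: plain SITEWISE pricing is the zero rule (any `R′ ρ`, `B ≥ 0`). [folklore] -/
theorem localDischargingRuleT_zero_iff {η₀ η₁ R A eUp κT CT R' ρ B : ℝ} (hB : 0 ≤ B) :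
    LocalDischargingRuleT η₀ η₁ R A eUp κT CT R' ρ B (fun _ _ _ _ => 0) ↔
      ∀ (N : ℕ) (y : Fin N → E3), Function.Injective y → Sep y → ∀ i : Fin N,
        eUp + κT * (1 - (if GoodAt η₁ y i then (1 : ℝ) else 0)) - CT * (if GoodAt η₀ y i then (1 : ℝ) else 0) ≤
          (∑ j, truncLJ R (dist (y i) (y j))) / 2 - A * densityProxy y i := by
  obtain ⟨h1, h2, h3⟩ := zero_rule_restricted (R' := R') (ρ := ρ) hB
  constructor
  · intro h N y hy hsep i
    simpa [netInflow] using h.2.2.2 N y hy hsep i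
  · intro h
    exact ⟨h1, h2, h3, fun N y hy hsep i => by simpa [netInflow] using h N y hy hsep i⟩

/-! ## §4. T′ / FDG / the crux BY NAME from a local discharging rule -/

/-- **`T′ ⟸ UP ∧ LocalDischargingRuleT`** at any range `R > 0` with the layer-cake floor `A_R = (4/3)(1 + 1/(2R))³/R³`, `κ_T > 0`. [folklore chaining] -/
theorem topologicalPricing_of_ruleT_tf {η₀ η₁ R eUp κT CT R' ρ B : ℝ} {F : TransferRule} (hR : 0 < R) (hU : PeriodicEnergyCeiling eUp)
    (hκ : 0 < κT) (h : LocalDischargingRuleT η₀ η₁ R (4 / 3 * (1 + 1 / (2 * R)) ^ 3 / R ^ 3) eUp κT CT R' ρ B F) :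
    TopologicalPricing η₀ η₁ :=
  topologicalPricing_of_rangeCut (tailFloor_holds hR) hU hκ (finiteRangeTopologicalPricing_of_rule h)

/-- **`FDG ⟸ E′ ∧ UP ∧ LocalDischargingRuleT`** (`η₁ ≥ 1/20`). [folklore chaining] -/
theorem fdg_of_ruleT_tf {η₁ R eUp κT CT R' ρ B : ℝ} {F : TransferRule} (h01 : (1 : ℝ) / 20 ≤ η₁) (hE : ElasticPricing (1 / 20) η₁)
    (hR : 0 < R) (hU : PeriodicEnergyCeiling eUp) (hκ : 0 < κT)
    (h : LocalDischargingRuleT (1 / 20) η₁ R (4 / 3 * (1 + 1 / (2 * R)) ^ 3 / R ^ 3) eUp κT CT R' ρ B F) : FDG :=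
  fdg_of_elastic_of_topological h01 hE (topologicalPricing_of_ruleT_tf hR hU hκ h)

/-- ★ **The crux from a local discharging rule beneath T′_R**:
`MuEquilibriumDoor ∧ E′(1/20,η₁) ∧ UP(eUp) ∧ LocalDischargingRuleT (1/20) η₁ R A_R eUp κ_T C_T R′ ρ B F ⟹ AperiodicFrustratedLawGap`. [folklore chaining] -/
theorem aperiodicFrustratedLawGap_of_ruleT_tf {η₁ R eUp κT CT R' ρ B : ℝ} {F : TransferRule} (h01 : (1 : ℝ) / 20 ≤ η₁)
    (hDoor : Summit.AtomisticToContinuum.Crystallization.Theses.GrainCoreNetworkSplit.MuEquilibriumDoor)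
    (hE : ElasticPricing (1 / 20) η₁) (hR : 0 < R) (hU : PeriodicEnergyCeiling eUp) (hκ : 0 < κT)
    (h : LocalDischargingRuleT (1 / 20) η₁ R (4 / 3 * (1 + 1 / (2 * R)) ^ 3 / R ^ 3) eUp κT CT R' ρ B F) :
    Summit.AtomisticToContinuum.Crystallization.Theses.FrustratedLawDichotomy.AperiodicFrustratedLawGap :=
  aperiodicFrustratedLawGap_of_fdg hDoor (fdg_of_ruleT_tf h01 hE hR hU hκ h)

/-- ★★ **The crux at the RESIDUAL OF RECORD `T′_7`** (critic row 487: `FiniteRangeTopologicalPricing (1/20) (1/8) 7 (1/324) (−0.7175) (1/100) C_T`,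
floor `TailFloor 7 (1/324)` PROVED, `…TailFloorAnnulus.tailFloor_seven_324`):
`MuEquilibriumDoor ∧ E′(1/20,1/8) ∧ UP(−0.7175) ∧ LocalDischargingRuleT (1/20) (1/8) 7 (1/324) (−0.7175) (1/100) C_T R′ ρ B F ⟹ AperiodicFrustratedLawGap`.
[folklore chaining] -/
theorem aperiodicFrustratedLawGap_of_ruleT_seven {CT R' ρ B : ℝ} {F : TransferRule}
    (hDoor : Summit.AtomisticToContinuum.Crystallization.Theses.GrainCoreNetworkSplit.MuEquilibriumDoor)
    (hE : ElasticPricing (1 / 20) (1 / 8)) (hU : PeriodicEnergyCeiling (-(7175 / 10000)))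
    (h : LocalDischargingRuleT (1 / 20) (1 / 8) 7 (1 / 324) (-(7175 / 10000)) (1 / 100) CT R' ρ B F) :
    Summit.AtomisticToContinuum.Crystallization.Theses.FrustratedLawDichotomy.AperiodicFrustratedLawGap :=
  aperiodicFrustratedLawGap_of_split_rangeCut (by norm_num) hDoor hE tailFloor_seven_324 hU (by norm_num)
    (finiteRangeTopologicalPricing_of_rule h)

/-- **`T′_7` itself from a rule** (the residual of record, for census bookkeeping). [folklore] -/
theorem finiteRangeTopologicalPricing_seven_of_rule {CT R' ρ B : ℝ} {F : TransferRule}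
    (h : LocalDischargingRuleT (1 / 20) (1 / 8) 7 (1 / 324) (-(7175 / 10000)) (1 / 100) CT R' ρ B F) :
    FiniteRangeTopologicalPricing (1 / 20) (1 / 8) 7 (1 / 324) (-(7175 / 10000)) (1 / 100) CT :=
  finiteRangeTopologicalPricing_of_rule h

/-- **The crux from a local discharging rule beneath FRG_R** (unsplit; any `R > 0`, `A = A_R`, level `e₁ > eUp`). [folklore chaining] -/
theorem aperiodicFrustratedLawGap_of_ruleF_tf {R eUp e₁ C R' ρ B : ℝ} {F : TransferRule}
    (hDoor : Summit.AtomisticToContinuum.Crystallization.Theses.GrainCoreNetworkSplit.MuEquilibriumDoor)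
    (hR : 0 < R) (hU : PeriodicEnergyCeiling eUp) (he : eUp < e₁)
    (h : LocalDischargingRuleF R (4 / 3 * (1 + 1 / (2 * R)) ^ 3 / R ^ 3) e₁ C R' ρ B F) :
    Summit.AtomisticToContinuum.Crystallization.Theses.FrustratedLawDichotomy.AperiodicFrustratedLawGap :=
  aperiodicFrustratedLawGap_of_rangeCut hDoor (tailFloor_holds hR) hU (finiteRangeFrustrationGap_of_rule h) he

/-- **The crux from a local discharging rule beneath FRG_7 at the audit-twin literal** (`A = 1/324`, level `−0.7174 > −0.7175`). [folklore chaining] -/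
theorem aperiodicFrustratedLawGap_of_ruleF_seven {C R' ρ B : ℝ} {F : TransferRule}
    (hDoor : Summit.AtomisticToContinuum.Crystallization.Theses.GrainCoreNetworkSplit.MuEquilibriumDoor)
    (hU : PeriodicEnergyCeiling (-(7175 / 10000)))
    (h : LocalDischargingRuleF 7 (1 / 324) (-(7174 / 10000)) C R' ρ B F) :
    Summit.AtomisticToContinuum.Crystallization.Theses.FrustratedLawDichotomy.AperiodicFrustratedLawGap :=
  aperiodicFrustratedLawGap_of_rangeCut hDoor tailFloor_seven_324 hU (finiteRangeFrustrationGap_of_rule h) (by norm_num)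

/-- **E′ from a local discharging rule beneath E′_R** (tail floor discharged, any `R > 0`). [folklore chaining] -/
theorem elasticPricing_of_ruleE_tf {η₀ η₁ R eUp κE CE DE R' ρ B : ℝ} {F : TransferRule} (hR : 0 < R) (hU : PeriodicEnergyCeiling eUp)
    (hκ : 0 < κE) (h : LocalDischargingRuleE η₀ η₁ R (4 / 3 * (1 + 1 / (2 * R)) ^ 3 / R ^ 3) eUp κE CE DE R' ρ B F) :
    ElasticPricing η₀ η₁ :=
  elasticPricing_of_rangeCut_tf hR hU hκ (finiteRangeElastic_of_rule h)

/-- ★ **BOTH strain currencies by local discharging rules at one range** (`R > 0`, `A = A_R`; rules `F_E`, `F_T` may differ):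
`MuEquilibriumDoor ∧ UP ∧ LocalDischargingRuleE ∧ LocalDischargingRuleT ⟹ AperiodicFrustratedLawGap`. [folklore chaining] -/
theorem aperiodicFrustratedLawGap_of_rules_tf {η₁ R eUp κE CE DE κT CT R' ρ B R'' ρ' B' : ℝ} {FE FT : TransferRule}
    (h01 : (1 : ℝ) / 20 ≤ η₁)
    (hDoor : Summit.AtomisticToContinuum.Crystallization.Theses.GrainCoreNetworkSplit.MuEquilibriumDoor)
    (hR : 0 < R) (hU : PeriodicEnergyCeiling eUp) (hκE : 0 < κE) (hκT : 0 < κT)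
    (hEr : LocalDischargingRuleE (1 / 20) η₁ R (4 / 3 * (1 + 1 / (2 * R)) ^ 3 / R ^ 3) eUp κE CE DE R' ρ B FE)
    (hTr : LocalDischargingRuleT (1 / 20) η₁ R (4 / 3 * (1 + 1 / (2 * R)) ^ 3 / R ^ 3) eUp κT CT R'' ρ' B' FT) :
    Summit.AtomisticToContinuum.Crystallization.Theses.FrustratedLawDichotomy.AperiodicFrustratedLawGap :=
  aperiodicFrustratedLawGap_of_ruleT_tf h01 hDoor (elasticPricing_of_ruleE_tf hR hU hκE hEr) hR hU hκT hTr

end Summit.AtomisticToContinuum.Crystallization.Theorems.FrustratedLawDichotomyLocalDischargingRule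

end
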